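import Summits.CriticalPhenomena.PercolationContinuityZ3.Theorems.PercNearOneGluingNoHeavyLowerTailPortSelection
import HarnessLib

/-!
# `NoHeavyLowerTail` (stmt-CriticalPhenomena-4575) — the TOP2 socket `noHeavyLowerTail_of_topTwoSelection`

Lemma factory #6 (`prim-lf-6`, gen 9), 2026-08-20.  Candidate B6.6 / §B9 of `run/shared/lean/prim/prim-lf-6/CANDIDATES.md`:
**TOP2** — for a valid port selection `c(·)` (Kozma–Nitzan's rule: per relay-free cluster class `V₀` of the observer, the port most
fragile AVOIDING `V₀`), the selected relay is light no more often than the TWO most fragile relays together,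
`Σ_{V₀} μ(o ↔ A ∧ c(V₀) light ∧ Blob V₀) ≤ μ(R_a) + μ(R_b)` for some relays `a, b` (`a = b` allowed, which only weakens the hypothesis).
This is the typed form of the census column `PI/TOP2 ≤ 1` (ttrl lf6/PI.md §S1S2: 0 violations in 2.7·10⁷ instances + 2.8·10⁴ exact climb
optima; lf-6 all-order ε-screens ≈ 2.3·10⁷ cases, C_lim = 1 exact).  It closes the crux through `noHeavyLowerTail_of_portSelection` with the
k-uniform constant `C = 2`.  No definitions, no sorries.
-/

namespace Summit.CriticalPhenomena.PercolationContinuityZ3.Theorems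

open MeasureTheory Set Literature.Probability.LatticeModels Literature.Probability.Percolation
open scoped Classical BigOperators

/-- **The TOP2 bound closes the crux** (lemma factory #6, candidate B6.6 'TOP2', typed).  If on every finite weighted graph, for every
nonempty relay set `A`, observer `o ∉ A` and level `j` there is a selection `c` — assigning to every blob `V₀ ∋ o` disjoint from `A` a
relay at least as fragile AVOIDING `V₀` as every relay adjacent to the blob — and two relays `a, b ∈ A` (not necessarily distinct) with
`Σ_{V₀} μ(o ↔ A ∧ |π(c(V₀))| ≤ j ∧ Blob(V₀)) ≤ μ(|π(a)| ≤ j) + μ(|π(b)| ≤ j)`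
("the relay selected by the observer's relay-free cluster is light, while the observer is attached, no more often than the two most
fragile relays are light, counted together"), then `NoHeavyLowerTail` holds.  Proof: the right-hand side is at most twice the lightness
probability of the more fragile of `a, b`, so `noHeavyLowerTail_of_portSelection` applies with the k-uniform constant `C = 2`.
[this work] -/
theorem noHeavyLowerTail_of_topTwoSelection
    (hTOP2 : ∀ (n : ℕ) (w : Sym2 (Fin n) → unitInterval) (A : Finset (Fin n)) (o : Fin n) (j : ℕ),
      A.Nonempty → o ∉ A → ∃ c : Finset (Fin n) → Fin n,
        (∀ V₀ : Finset (Fin n), o ∈ V₀ → Disjoint V₀ A → c V₀ ∈ A ∧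
          ∀ v ∈ A, (∃ u ∈ V₀, w s(u, v) ≠ 0) →
            (Literature.Probability.LatticeModels.prodBernoulli w).real
                {ω : Literature.Probability.Percolation.BondConfig (Fin n) |
                  (A.filter fun z => ω ∈ Literature.Probability.Percolation.openConnIn ((↑V₀ : Set (Fin n))ᶜ) v z).card ≤ j} ≤
              (Literature.Probability.LatticeModels.prodBernoulli w).real
                {ω : Literature.Probability.Percolation.BondConfig (Fin n) |
                  (A.filter fun z => ω ∈ Literature.Probability.Percolation.openConnIn ((↑V₀ : Set (Fin n))ᶜ) (c V₀) z).card ≤ j}) ∧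
        ∃ a ∈ A, ∃ b ∈ A,
          ∑ V₀ ∈ (Finset.univ : Finset (Finset (Fin n))).filter (fun V₀ => o ∈ V₀ ∧ Disjoint V₀ A),
            (Literature.Probability.LatticeModels.prodBernoulli w).real
              ({ω : Literature.Probability.Percolation.BondConfig (Fin n) |
                  1 ≤ (A.filter fun x => ω ∈ Literature.Probability.Percolation.openConn o x).card} ∩
                {ω : Literature.Probability.Percolation.BondConfig (Fin n) |
                  (A.filter fun x => ω ∈ Literature.Probability.Percolation.openConn (c V₀) x).card ≤ j} ∩
                {ω : Literature.Probability.Percolation.BondConfig (Fin n) |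
                  (∀ u ∈ V₀, ω ∈ Literature.Probability.Percolation.openConnIn (↑V₀ : Set (Fin n)) o u) ∧
                    ∀ u ∈ V₀, ∀ x, x ∉ V₀ → x ∉ A → s(u, x) ∉ ω}) ≤
          (Literature.Probability.LatticeModels.prodBernoulli w).real
              {ω : Literature.Probability.Percolation.BondConfig (Fin n) |
                (A.filter fun x => ω ∈ Literature.Probability.Percolation.openConn a x).card ≤ j} +
            (Literature.Probability.LatticeModels.prodBernoulli w).real
              {ω : Literature.Probability.Percolation.BondConfig (Fin n) |
                (A.filter fun x => ω ∈ Literature.Probability.Percolation.openConn b x).card ≤ j}) :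
    Summit.CriticalPhenomena.PercolationContinuityZ3.Theses.PercNearOneGluing.NoHeavyLowerTail := by
  refine noHeavyLowerTail_of_portSelection 2 (by norm_num) fun n w A o j hA hoA => ?_
  obtain ⟨c, hc, a, ha, b, hb, hsum⟩ := hTOP2 n w A o j hA hoA
  refine ⟨c, hc, ?_⟩
  -- the more fragile of `a`, `b` carries the constant 2
  by_cases hab :
      (prodBernoulli w).real {ω : BondConfig (Fin n) | (A.filter fun x => ω ∈ openConn b x).card ≤ j} ≤
        (prodBernoulli w).real {ω : BondConfig (Fin n) | (A.filter fun x => ω ∈ openConn a x).card ≤ j}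
  · exact ⟨a, ha, hsum.trans (by linarith)⟩
  · push Not at hab
    exact ⟨b, hb, hsum.trans (by linarith)⟩

end Summit.CriticalPhenomena.PercolationContinuityZ3.Theorems
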